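import Summits.QuantumFields.YangMills.Theorems.BalabanUVNodesN05SubBP2DK2PerKappaSlotExistsOfBindersLettersPerDoorL

/-!
# BalabanUVNodes ∕ N05 → N16 ([Balaban1985RegularSpaces] Thm 4 p. 88, Prop. 3 p. 87, Prop. 5 p. 94, (1.3)–(1.5) p. 77, p. 77 «Ω_j ⊂ T_η»;
# [Balaban1985BackgroundPropagators] Thm 3.1 p. 397, Thm 3.3 p. 399, Thm 3.11 p. 416): EDITION «Σ» OF THE DOOR ζ-L — THEOREM 4's AND PROPOSITION 3's BODIES WITH
# ONE THRESHOLD PAIR `(c₄, c₃)` AND ONE LETTER SET `(inp, B₀β, B₈)` AT EVERY PRINT-CLASS PERIODIC MEMBER OF EVERY PERIOD `Pf ν`, `ν : ι`, from ζ-L's displayed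
# hypotheses (NODE N06's five binders, [4]'s two letter families) indexed additionally by the period — the (g6) seam item of the edge N05 → N16 (dag-n16-e g23)

Track A of `YM-PLAN.md` (cell `pub-ymgap`, HUMAN RULING D-0062), node **N05**, edge N05 → N16; seat `pub-ymgap-dag-n05-d` (g22), 2026-08-29; count-neutral helper
(`--supports`, proves no registered stub).

WHY (dag-n16-e g23, `LOCATED-N16-N05-RECORD-CURRENCY.md`, item (g6); pub-ymgap INBOX I.43762 ∕ I.44104).  Node N16's chain entry
`…N16HolderOfThm4Output.n16_holder_of_thm4TorusAt_print` consumes, for EVERY depth `k ≥ 1`, Theorem 4 on the torus of period `P_k = N·Lᵏ` with ONE threshold `c₁` and ONE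
constant pair `(B, B_h)`; its reader of node N05's witness slot of record (`…N16Thm4TorusOfHP2PerPrintSlot`, `…Entry`, p679634) opens, at each period separately, the slot's
conjuncts `t4 : B8.Thm4Printed …` and `p3 : B8.Prop3Printed …` — both `∃ c > 0, Body c …` BY DEFINITION (`B8.Thm4Printed`, `B8.Prop3Printed`) — and therefore obtains a
threshold pair PER PERIOD, with no common bound.  In the N05 chain of record every such threshold is in fact chosen BEFORE the member and the period
(`B8Thm4CoreZdGF3HP2PerLanEGamma.thm4Core_zdGF3HP₂Per_map_lanE_γ'`: `c₁ := min c₁ᵘ (min cγ cw')` from `thm4Body_concrete_uniform_lanE_γ'_per` and the two window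
lemmas, functions of `(d, L, B₀, B₀′, c_u, c_P, γ′, B₈)` only; `B8Prop3PrintedZdGF3P2GammaOfSockPer.prop3Body_member_hp2per_γ_of_sockB9P3H2Per`: threshold before member
and period), every server of the chain is INDEX-GENERIC (`(ι : J → ZdIdx d L) (p : J → ℕ)`), and the layer's letters are P-free functions of the OUTER constants (ζ-L's door
recipe).  THIS FILE makes that uniformity a theorem: it reads the index-generic servers at the ALL-PERIODS index `J := Σ ν : ι, IdxB8SubDPerκ θ (Pf ν) Mκ Rκ`
(`ι q := q.2.toZdIdx`, `p q := Pf q.1`) for an arbitrary family of periods `Pf : ι → ℕ` (N16: `ι := {k ∕∕ 1 ≤ k}`, `Pf k := N·Lᵏ`; a single period: `ι := Unit`).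

WHAT IS PROVED (by-name composition + real arithmetic on constants; no estimate, no definition, no `sorry`).
* ★★★ `exists_thm4Body_prop3Body_uniformP_of_bindersLettersPer_doorL` — from ζ-L's OUTER data VERBATIM (`hD`, `[FiniteDimensional ℝ θ.𝔸]`, `Mκ Rκ`, N06's record data
  `τ hτp hτt hτs C_τ ops₀ M`, N06's binder constants `a_I a_T a_S B₀ᴺ C_β c_S c_Sβ` with signs, the Hölder pair `β len`, [4]'s letter constants `B₀′ᴴ B₂′ B_G B_R c_L` with
  signs) and ζ-L's seven displayed families `hinv hglob hhol hsrc hsrcH hLet SLetUB` — texts VERBATIM, now at EVERY period `Pf ν` (one more binder `ν : ι`, constants ν-free):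
  `∃ (inp : B8.B9Inputs) (B₀β B₈ c₄ c₃ : ℝ)` with the faces `inp.B₀ = max 1 (2B₀ᴺ·max 1 (qQ D L C_τ (betaTau τ) 1))`, `inp.B₀′ = 6(2DL²)B_G B_R + 1`,
  `B₀β = 2·max 0 C_β·max 1 (qQ …)` (N06's pinned expressions, ζ-L's recipe), `inp.B₀ ≤ B₈`, `0 < c₄`, `0 < c₃`, and for every `ν : ι`, every `a : IdxB8SubDPerκ θ (Pf ν) Mκ Rκ`:
  `B8.Thm4Body c₄ (5·D·L·B₈) (fun _ : Unit => (zdGF3HP₂Per θ.𝔸 θ.L β len a.toZdIdx (Pf ν)).toGFData)` and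
  `B8.Prop3Body c₃ θ.D θ.L (2097152((D:ℝ)+1)²L²) inp B₀β (fun _ : Unit => (zdGF3HP₂Per θ.𝔸 θ.L β len a.toZdIdx (Pf ν)).toGFData2)` — i.e. the slot's `t4`∕`p3` BODIES in the
  EXACT letters of node N16's member lemma `…N16Thm4TorusOfHP2PerPrint.thm4TorusAt_print_of_hp2per_member` (its `hT`, `hP`), with NOTHING depending on the period but the member.
RECIPE (ζ-L's, [Balaban1985RegularSpaces] Thm 4 ∕ Thm 8 constants): `B₀, B₀β, γ′ := 2c_S∕B₀, γβ` = N06's pinned expressions at `γ₈ := 1`; `B₀′ := 6(2DL²)B_G B_R + 1`;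
`B₈ := B₀ + γ′B₀ + 1` (ζ-L has Proposition 6's `B₁⋆` in place of the final `1`: Theorem 4 and Proposition 3 do not read Proposition 6, and N16 reads `B₈` only through
`B₁′ = 5DL·B₈` in its threshold window; the conclusion letters `B = 5DL·inp.B₀`, `B_h = 5DL·B₀β` of N16's entry are ζ-L's to the letter); the inequalities by dag-n05-c's
`door_arith`; the socket thresholds as in (13)′α…ε-L (`c_P₃`, `c_P₃′`, `c_P₇` from the binder constants; `c_W`, `c_γ` from dag-n05-w4's ∕ lit-balaban's window lemmas;
`(c_u, c_P⁵ᵘ)` from `sockP5uSrcPer_of_lettersAtPerNested`) — ALL chosen before the period; the four sourced guarded sockets of Theorem 4's frame and the both-points socket of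
Proposition 3's frame SERVED at every `(ν, a)` by NODE N06's index-generic binder→socket theorems (`sockH59srcPer_opsAllZdPer_towerBondsP`,
`sockB9P3H2Per_opsAllZdPer_towerBondsP`) and lit-balaban's index-generic nested Proposition-5 servers (`sockP5baseSrcPerL ∕ sockP5SrcPerL_of_lettersAtPerNested`) read at `J`;
then `thm4Body_zdGF3HP₂Per_mapJ_γ'` at `J` and `prop3Body_member_hp2per_γ_of_sockB9P3H2Per`.
CONSUMER (dag-n16-e successor, top knit): `obtain ⟨inp, B₀β, B₈, c₄, c₃, hB₀, hB₀', hB₀β, hBB, hc₄, hc₃, H⟩ := exists_thm4Body_prop3Body_uniformP_of_bindersLettersPer_doorL θ …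
(Pf := fun k => N * θ.L ^ k.1) …`; per `k`: `(H k a).1 ()` is `hT`, `(H k a).2 ()` is `hP` of `thm4TorusAt_print_of_hp2per_member` with `c₁ := c₄`, `cP := c₃`,
`B₁' := 5·D·L·B₈`, `C₂ := 2097152((D:ℝ)+1)²L²` — ONE window for all `k`.
HONEST FRAMING: composition BY NAME; 0 estimates of Bałaban's proved here; NODE N06's five analytic binders and [4]'s two periodic letter families remain HYPOTHESES, now asked at
EVERY period of the family with ν-UNIFORM constants (print's shape: Thm 4's `c₁` and [4]'s constants are absolute; the tree's N06 object layer serves the binders per member by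
compactness — dag-n06-b LOCATED-SELF-9 — so the ν-uniform families are NOT yet inhabited by objects); the slot of record itself (ζ-L, R467) is untouched and not re-proved;
count-neutral; N05's booking unchanged; N16 ∕ N06 NOT discharged; K1⁹ ∕ K3⁸ OPEN; Bałaban AS PRINTED; one finite 𝕋⁴ programme at fixed ε; nothing continuum ∕ ℝ⁴ ∕ OS ∕
mass-gap ∕ Clay.  No `sorry`, no new definition.  Unit `pub-ymgap-dag-n05-d` (g22).
[cite: Balaban1985RegularSpaces, Thm 4 p.88 («there exists a constant c₁»), Prop. 3 p.87, Prop. 5 (1.107)–(1.109) p.94, Thm 8 (1.146) p.101, (1.3)–(1.6) p.77, p.77 («Ω_j ⊂ T_η»), §3 p.98; Balaban1985BackgroundPropagators, Thm 3.1 p.397, Thm 3.3 p.399, (3.40) p.397, (3.42)–(3.47) p.398, Thm 3.11 p.416]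
-/

noncomputable section

namespace Summit.QuantumFields.YangMills.BalabanUVNodes.N05SubBP2DK2PerKappaThm4Prop3BodiesUniformPOfBindersLettersPerDoorL

open Literature.MathematicalPhysics.QuantumFieldTheory.Balaban1983to89
open Literature.MathematicalPhysics.QuantumFieldTheory.Balaban1983to89.Node00
open Literature.MathematicalPhysics.QuantumFieldTheory.Balaban1983to89.B8IdxB8LawsB (IdxB8LawsB IdxB8SubB)
open Literature.MathematicalPhysics.QuantumFieldTheory.Balaban1983to89.B8LeafModelZd (ZdIdx)
open Literature.MathematicalPhysics.QuantumFieldTheory.Balaban1983to89.B8LeafModelZdHP2Per (zdGF3HP₂Per)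
open Literature.MathematicalPhysics.QuantumFieldTheory.Balaban1983to89.B8TowerBondsPrinted (towerBondsP)
open Literature.MathematicalPhysics.QuantumFieldTheory.Balaban1983to89.B8Lemma1NonAbelian (mulCfg)
open Literature.MathematicalPhysics.QuantumFieldTheory.Balaban1983to89.B8LanF146 (LanF146 lanF146_zero_iff)
open Literature.MathematicalPhysics.QuantumFieldTheory.Balaban1983to89.B8Eq138LandauZd (inR138_zero)
open Literature.MathematicalPhysics.QuantumFieldTheory.Balaban1983to89.B8Prop5LandauDataZdPer (zdLanPer)
open Literature.MathematicalPhysics.QuantumFieldTheory.Balaban1983to89.B8Prop5LandauDataZd (ZdLanIdx)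
open Literature.MathematicalPhysics.QuantumFieldTheory.Balaban1983to89.B8LeafModelZd3SockH2Per (SockB9P3H2Per)
open Literature.MathematicalPhysics.QuantumFieldTheory.Balaban1983to89.B9SupplySockB9P3ZdSrcPer (SrcAtIPer SrcHolderAtIH2Per)
open Literature.MathematicalPhysics.QuantumFieldTheory.Balaban1983to89.B9SupplySockB9P3ZdLetters (OpsZd)
open Literature.MathematicalPhysics.QuantumFieldTheory.Balaban1983to89.B9Eq327GreenZdHermPer (InvAtHIPer)
open Literature.MathematicalPhysics.QuantumFieldTheory.Balaban1983to89.B9SupplySockB9P3ZdPer (GlobAtIPer)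
open Literature.MathematicalPhysics.QuantumFieldTheory.Balaban1983to89.B9SupplySockB9P3ZdH2Per (HolderAtIH2Per)
open Literature.MathematicalPhysics.QuantumFieldTheory.Balaban1983to89.B9SupplySockB9P3ZdAllLettersZdPer (opsAllZdPer)
open Literature.MathematicalPhysics.QuantumFieldTheory.Balaban1983to89.B9Eq316AveragingTransposeZd (betaTau qQ)
open Literature.MathematicalPhysics.QuantumFieldTheory.Balaban1983to89.B9SupplySockH59ZdSrcPer (sockH59srcPer_opsAllZdPer_towerBondsP)
open Literature.MathematicalPhysics.QuantumFieldTheory.Balaban1983to89.B9SupplySockB9P3ZdH2PerClass (sockB9P3H2Per_opsAllZdPer_towerBondsP)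
open Literature.MathematicalPhysics.QuantumFieldTheory.Balaban1983to89.B9Eq316AveragingTransposeZdLevelZero (LevelSepPP0 levelSepPP0_of_levelSepPP)
open Literature.MathematicalPhysics.QuantumFieldTheory.Balaban1983to89.B8TowerBondsLayerLawSubD (IdxB8SubD.levelSepPP_towerBondsP)
open Literature.MathematicalPhysics.QuantumFieldTheory.Balaban1983to89.B8Prop5NestedServerSrcPerL (sockP5SrcPerL_of_lettersAtPerNested sockP5baseSrcPerL_of_lettersAtPerNested)
open Literature.MathematicalPhysics.QuantumFieldTheory.Balaban1983to89.B8SockWindowsSrc (hfpWindows_of_guard_src)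
open Literature.MathematicalPhysics.QuantumFieldTheory.Balaban1983to89.B8SockP5uEProviderGamma (gammaWindows_of_guard)
open Literature.MathematicalPhysics.QuantumFieldTheory.Balaban1983to89.B8SockSP5uNestedSrcPer (sockP5uSrcPer_of_lettersAtPerNested)
open Literature.MathematicalPhysics.QuantumFieldTheory.Balaban1983to89.B8Thm4ZdGF3HP2PerMapGammaPrime (thm4Body_zdGF3HP₂Per_mapJ_γ')
open Literature.MathematicalPhysics.QuantumFieldTheory.Balaban1983to89.B8Prop3PrintedZdGF3P2GammaOfSockPer (prop3Body_member_hp2per_γ_of_sockB9P3H2Per)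
open Summit.QuantumFields.YangMills.BalabanUVNodes.N05SubBP2DK2PerKappaSlotExistsOfBindersPerP5Letters (IdxB8SubDPer.Λs_add_div_smul_iff)
open Summit.QuantumFields.YangMills.BalabanUVNodes.N05SubBP2DK2PerKappaSlotExistsOfBindersLettersPerDoor (door_arith)
open T4TermwiseTorus (IsPeriodic)
open MatrixLog B7Prop1Explicit B7Prop2Explicit B7Prop1Local B7Eq92Concrete
open B8Ineq130 (tlo thi)
open B8Ineq132 (InAk covDerivFwd)
open B8Eq119TwistedAxial (Restr129 InAx bgT)
open B8Eq140Level (SideTouches)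
open B8Eq138LandauZd (covLap covDivB QT logCfg InR138 IsLandau146W)
open B8Eq184Proof (gaugeExp cfgExp)
open B8Eq146AExpansion (iEta plaqCovDeriv)
open B8Eq143PlaqExpansion (pdiv)
open B7Prop4GeneralLevels (linCovIter)
open B8Eq155JBound (Jcur wsup)
open B8ScaledSupNorm (bondNorm msup Bdd msup_le bdd_of_forall)
open B9Eq340HolderZd (hquot AdmPair)
open B7Eq78Linearization (zdBlocking QprimeIter)
open B8Eq1117Concrete (XSpace)
open B8Prop5ContractionKLevel (Bd2)
open B8LambdaSpaceKLevel (wt)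
-- `Site` alone could resolve to the torus sites of `Setup.lean`; re-export the `ℤ^d` sites of `B7Prop1Explicit`.
export B7Prop1Explicit (Site)

/-! ## Theorem 4's and Proposition 3's bodies, one threshold pair and one letter set for a whole family of periods -/

section UniformP

variable (θ : Stage3Params)

/-- ★★★ EDITION «Σ» — **THEOREM 4's AND PROPOSITION 3's BODIES WITH ONE THRESHOLD PAIR AND ONE LETTER SET AT EVERY PRINT-CLASS PERIODIC MEMBER OF EVERY PERIOD `Pf ν`**,
from ζ-L's OUTER data and ζ-L's seven displayed families (NODE N06's five analytic binders ∀ (member, truncation), [4]'s existence letters in the small-field class `α₀ ≤ c_L`,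
[4]'s uniqueness letters) asked at every period of the family `Pf : ι → ℕ` with ν-free constants: `∃ inp B₀β B₈ c₄ c₃` (faces: N06's pinned `inp.B₀`, `B₀β`; `inp.B₀′`;
`inp.B₀ ≤ B₈`; `0 < c₄, c₃`) with `B8.Thm4Body c₄ (5DL·B₈)` and `B8.Prop3Body c₃ D L (2097152(D+1)²L²) inp B₀β` at the `Unit`-family of every member `a.toZdIdx` at its period
`Pf ν` — the `hT ∕ hP` inputs of node N16's `thm4TorusAt_print_of_hp2per_member`, nothing period-dependent but the member.
[cite: Balaban1985RegularSpaces, Thm 4 p.88 («there exists a constant c₁»), Prop. 3 p.87, Prop. 5 (1.107)–(1.109) p.94, Thm 8 (1.146) p.101, (1.3)–(1.5) p.77, p.77 («Ω_j ⊂ T_η»); Balaban1985BackgroundPropagators, Thm 3.1 p.397, Thm 3.3 p.399, Thm 3.11 p.416] -/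
theorem exists_thm4Body_prop3Body_uniformP_of_bindersLettersPer_doorL (hD : 2 ≤ θ.D) [FiniteDimensional ℝ θ.𝔸] (Mκ Rκ : ℕ)
    -- THE FAMILY OF PERIODS (N16: `ι := {k ∕∕ 1 ≤ k}`, `Pf k := N·Lᵏ`; one period: `ι := Unit`)
    {ι : Type} (Pf : ι → ℕ)
    -- NODE N06's GENUINE TORUS RECORD DATA: a faithful Hermitian tracial state `τ` with its Cauchy–Schwarz constant `C_τ`, the base letters `ops₀`, the block parameter `M ≥ 1`
    (τ : θ.𝔸 →ₗ[ℂ] ℂ) (hτp : ∀ a : θ.𝔸, a ≠ 0 → 0 < (τ (star a * a)).re) (hτt : ∀ a b : θ.𝔸, τ (a * b) = τ (b * a))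
    (hτs : ∀ a : θ.𝔸, τ (star a) = starRingEnd ℂ (τ a)) {Cτ : ℝ} (hCτ : ∀ x y : θ.𝔸, |(τ (star x * y)).re| ≤ Cτ * ‖x‖ * ‖y‖)
    (ops₀ : ℝ → ZdIdx θ.D θ.L → ℕ → OpsZd θ.D θ.𝔸) {M : ℝ} (hM1 : 1 ≤ M)
    -- NODE N06's BINDER CONSTANTS ([4] Thm 3.11's `a_I`, (3.47)'s `a_T, B₀ᴺ`, (3.45)'s `C_β`, the source binders' `a_S, c_S, c_Sβ`) — OUTER, ν-free
    {aI aT aS B₀N Cβ cS cSβ : ℝ} (haI : 0 < aI) (haT : 0 < aT) (haS : 0 < aS) (hB₀N : 0 < B₀N) (hCβ : 0 < Cβ) (hcS : 0 ≤ cS) (hcSβ : 0 ≤ cSβ)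
    -- the Hölder pair of the layer — OUTER
    {β : ℝ} {len : Site θ.D → ℝ}
    -- [4]'s PROPOSITION-5 LETTER CONSTANTS ((1.92)'s `B₀′ᴴ, B₂′`, (1.101)'s `B_G`, (1.98)'s `B_R`), the regularity threshold `c_L > 0` — OUTER, ν-free
    {B₀'H B₂' BG BR cL : ℝ} (hB₀'H : 0 < B₀'H) (hB₂' : 0 ≤ B₂') (hBG : 0 ≤ BG) (hBR : 0 ≤ BR) (hcL : 0 < cL)
    -- NODE N06's FIVE ANALYTIC BINDERS PER MEMBER AT EVERY TRUNCATION `m ≤ k`, at the genuine torus record with print's class (1.31) — HYPOTHESES ([4] Thm 3.11,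
    -- (3.47)@−3, (3.45), (3.42)₃∕(3.43); dag-n06-b `B9SupplySockH59ZdSrcPer` §3's displayed inputs VERBATIM at every period `Pf ν`; N06's object layer inhabits them)
    (hinv : ∀ (ν : ι) (a : IdxB8SubDPerκ θ (Pf ν) Mκ Rκ) (m : ℕ), m ≤ a.toZdIdx.k →
      InvAtHIPer (Pf ν) θ.L (opsAllZdPer τ θ.L (Pf ν) (fun k j => towerBondsP θ.L a.toZdIdx.Ω (a.toZdIdx.Λs k) j) ops₀) aI M a.toZdIdx m)
    (hglob : ∀ (ν : ι) (a : IdxB8SubDPerκ θ (Pf ν) Mκ Rκ) (m : ℕ), m ≤ a.toZdIdx.k →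
      GlobAtIPer (Pf ν) θ.L (opsAllZdPer τ θ.L (Pf ν) (fun k j => towerBondsP θ.L a.toZdIdx.Ω (a.toZdIdx.Λs k) j) ops₀) aT B₀N M a.toZdIdx m)
    (hhol : ∀ (ν : ι) (a : IdxB8SubDPerκ θ (Pf ν) Mκ Rκ) (m : ℕ), m ≤ a.toZdIdx.k →
      HolderAtIH2Per (Pf ν) θ.L (opsAllZdPer τ θ.L (Pf ν) (fun k j => towerBondsP θ.L a.toZdIdx.Ω (a.toZdIdx.Λs k) j) ops₀) aT Cβ β len M a.toZdIdx m)
    (hsrc : ∀ (ν : ι) (a : IdxB8SubDPerκ θ (Pf ν) Mκ Rκ) (m : ℕ), m ≤ a.toZdIdx.k →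
      SrcAtIPer (Pf ν) θ.L (opsAllZdPer τ θ.L (Pf ν) (fun k j => towerBondsP θ.L a.toZdIdx.Ω (a.toZdIdx.Λs k) j) ops₀) aS cS M a.toZdIdx m)
    (hsrcH : ∀ (ν : ι) (a : IdxB8SubDPerκ θ (Pf ν) Mκ Rκ) (m : ℕ), m ≤ a.toZdIdx.k →
      SrcHolderAtIH2Per (Pf ν) θ.L (opsAllZdPer τ θ.L (Pf ν) (fun k j => towerBondsP θ.L a.toZdIdx.Ω (a.toZdIdx.Λs k) j) ops₀) aS cSβ β len M a.toZdIdx m)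
    -- [4]'s LETTERS AT PERIODIC ARGUMENTS — HYPOTHESES (NODE N06's periodic letters ∕ lit-balaban to serve; [Balaban1985BackgroundPropagators] Thm 3.1 p. 397, Thms 3.2–3.3):
    -- (E) the EXISTENCE letters at every print-class periodic member, every unitary `P`-periodic background in the SMALL-FIELD class `𝔄_k({Ω_j}, α₀)`,
    -- `0 < α₀ ≤ c_L` ([4] Thm 3.1's regime), every truncation `1 ≤ n ≤ k` — `B8Prop5NestedServerSrcPerL`'s thresholded `hLet` text VERBATIM (= dag-n05-c's
    -- `…P5FrameSocketsServedL` displayed input; the currency-2 existence letters `SLet` are its truncation-`k` instance);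
    -- (U) the UNIQUENESS letters at the periodic members of record `a : IdxB8LanCκPer θ (Pf ν) Mκ Rκ` — `B8Prop5UniqueZdLanPer`'s `SLetUBper` VERBATIM (as in (13)′β∕δ)
    (hLet : ∀ (ν : ι) (a : IdxB8SubDPerκ θ (Pf ν) Mκ Rκ), ∀ α₀ : ℝ, 0 < α₀ → α₀ ≤ cL → ∀ U₀ : Site θ.D → Fin θ.D → θ.𝔸ˣ, (∀ x κ, U₀ x κ ∈ unitaryUnits θ.𝔸) → IsPeriodic (Pf ν) U₀ →
      InAk θ.L a.toZdIdx.k a.toZdIdx.η α₀ a.toZdIdx.Ω U₀ → ∀ n, 1 ≤ n → n ≤ a.toZdIdx.k →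
      ∃ (g Δ : (Site θ.D → θ.𝔸) →ₗ[ℂ] (Site θ.D → θ.𝔸)) (q : (Site θ.D → θ.𝔸) →ₗ[ℂ] (ℕ → Site θ.D → θ.𝔸)) (qs : (ℕ → Site θ.D → θ.𝔸) →ₗ[ℂ] (Site θ.D → θ.𝔸))
        (Aw c : (ℕ → Site θ.D → θ.𝔸) →ₗ[ℂ] (ℕ → Site θ.D → θ.𝔸)) (H' : XSpace θ.D n θ.𝔸 →ₗ[ℂ] (Site θ.D → θ.𝔸)),
        (∀ x, (∀ (z : Site θ.D) (i : Fin θ.D), x (z + (Pf ν : ℤ) • e i) = x z) → ∀ y ∈ a.toZdIdx.Ω 0, (Δ (g x) + qs (Aw (q (g x)))) y = x y) ∧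
        (∀ f, (∀ (z : Site θ.D) (i : Fin θ.D), f (z + (Pf ν : ℤ) • e i) = f z) → q (g (g (qs (c (q f))))) = q f) ∧
        (∀ (f : Site θ.D → θ.𝔸) (z : Site θ.D) (i : Fin θ.D), g f (z + (Pf ν : ℤ) • e i) = g f z) ∧
        (∀ f : Site θ.D → θ.𝔸, (∀ (z : Site θ.D) (i : Fin θ.D), f (z + (Pf ν : ℤ) • e i) = f z) →
      ∀ (z : Site θ.D) (i : Fin θ.D), qs (c (q f)) (z + (Pf ν : ℤ) • e i) = qs (c (q f)) z) ∧
        (∀ (f : Site θ.D → θ.𝔸), ∀ x ∈ a.toZdIdx.Ω 0, Δ f x = covLap a.toZdIdx.η U₀ ((a.toZdIdx.Ω 0).indicator f) x) ∧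
        (∀ (μ : ℕ → Site θ.D → θ.𝔸), ∀ x ∈ a.toZdIdx.Ω 0, qs μ x = QT θ.L n (a.toZdIdx.Λs n) U₀ μ x) ∧
        (∀ (f : Site θ.D → θ.𝔸) (j : ℕ), j ≤ n → ∀ y ∈ a.toZdIdx.Λs n j, q f j y = QprimeIter (zdBlocking θ.D θ.L) (bgT θ.L U₀) j f y) ∧
        (∀ (X : XSpace θ.D n θ.𝔸) (x : Site θ.D), ‖H' X x‖ ≤ B₀'H * ‖X‖) ∧
        (∀ j, j ≤ n → ∀ (X : XSpace θ.D n θ.𝔸), ∀ b ∈ {b : Site θ.D × Fin θ.D | SideTouches (a.toZdIdx.Ω j) b.1 b.2},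
      wt θ.L a.toZdIdx.η j * ‖covDerivFwd a.toZdIdx.η U₀ b.2 (H' X) b.1‖ ≤ B₀'H * ‖X‖) ∧
        (∀ X : XSpace θ.D n θ.𝔸, Bd2 θ.L a.toZdIdx.η n a.toZdIdx.Ω (covLap a.toZdIdx.η U₀ (H' X)) (B₂' * ‖X‖)) ∧
        (∀ (X : XSpace θ.D n θ.𝔸) (x : Site θ.D), x ∉ a.toZdIdx.Ω 0 → H' X x = 0) ∧
        (∀ X Y : XSpace θ.D n θ.𝔸, (∀ b, Y b = -star (X b)) → ∀ x, H' Y x = -star (H' X x)) ∧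
        (∀ X : XSpace θ.D n θ.𝔸, (∀ (b : Fin (n + 1) × Site θ.D) (i : Fin θ.D), X (b.1, b.2 + ((Pf ν : ℤ) / (θ.L : ℤ) ^ (b.1 : ℕ)) • e i) = X b) →
      ∀ (z : Site θ.D) (i : Fin θ.D), H' X (z + (Pf ν : ℤ) • e i) = H' X z) ∧
        (∀ (Y : XSpace θ.D n θ.𝔸), (∀ (b : Fin (n + 1) × Site θ.D) (i : Fin θ.D), Y (b.1, b.2 + ((Pf ν : ℤ) / (θ.L : ℤ) ^ (b.1 : ℕ)) • e i) = Y b) →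
      ∀ (j : ℕ) (hj : j ≤ n) (y : Site θ.D), y ∈ a.toZdIdx.Λs n j →
      QprimeIter (zdBlocking θ.D θ.L) (bgT θ.L U₀) j (H' Y) y = Y (⟨j, Nat.lt_succ_of_le hj⟩, y)) ∧
        (∀ (f : Site θ.D → θ.𝔸) (r : ℝ), 0 ≤ r → Bd2 θ.L a.toZdIdx.η n a.toZdIdx.Ω f r →
      (∀ x, ‖g f x‖ ≤ BG * r) ∧ ∀ j, j ≤ n → ∀ b ∈ {b : Site θ.D × Fin θ.D | SideTouches (a.toZdIdx.Ω j) b.1 b.2},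
        wt θ.L a.toZdIdx.η j * ‖covDerivFwd a.toZdIdx.η U₀ b.2 (g f) b.1‖ ≤ BG * r) ∧
        (∀ (f : Site θ.D → θ.𝔸) (x : Site θ.D), x ∉ a.toZdIdx.Ω 0 → g f x = 0) ∧
        (∀ f : Site θ.D → θ.𝔸, (∀ j, j ≤ n → ∀ x ∈ a.toZdIdx.Ω j, IsSelfAdjoint (f x)) → ∀ x, IsSelfAdjoint (g f x)) ∧
        (∀ (f : Site θ.D → θ.𝔸) (r : ℝ), 0 ≤ r → Bd2 θ.L a.toZdIdx.η n a.toZdIdx.Ω f r → Bd2 θ.L a.toZdIdx.η n a.toZdIdx.Ω (f - g (qs (c (q (g f))))) (BR * r)) ∧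
        (∀ f : Site θ.D → θ.𝔸, (∀ j, j ≤ n → ∀ x ∈ a.toZdIdx.Ω j, IsSelfAdjoint (f x)) →
      ∀ j, j ≤ n → ∀ x ∈ a.toZdIdx.Ω j, IsSelfAdjoint ((f - g (qs (c (q (g f))))) x)))
    (SLetUB : ∀ (ν : ι) (a : IdxB8LanCκPer θ (Pf ν) Mκ Rκ), ∀ α₀ : ℝ, 0 < α₀ → α₀ ≤ cL → InAk θ.L a.toZdLanIdx.k a.toZdLanIdx.η α₀ a.toZdLanIdx.Ω a.toZdLanIdx.U₀ →
      ∃ (g Δ : (Site θ.D → θ.𝔸) →ₗ[ℂ] (Site θ.D → θ.𝔸)) (q : (Site θ.D → θ.𝔸) →ₗ[ℂ] (ℕ → Site θ.D → θ.𝔸)) (qs : (ℕ → Site θ.D → θ.𝔸) →ₗ[ℂ] (Site θ.D → θ.𝔸))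
        (Aw c : (ℕ → Site θ.D → θ.𝔸) →ₗ[ℂ] (ℕ → Site θ.D → θ.𝔸)) (H' : XSpace θ.D a.toZdLanIdx.k θ.𝔸 →ₗ[ℂ] (Site θ.D → θ.𝔸)),
        (∀ x : Site θ.D → θ.𝔸, (∀ (z : Site θ.D) (i : Fin θ.D), x (z + (Pf ν : ℤ) • e i) = x z) → (∃ C : ℝ, ∀ y, ‖x y‖ ≤ C) →
          g (Δ x + qs (Aw (q x))) = x) ∧
        (∀ φ : ℕ → Site θ.D → θ.𝔸, (∀ n, n ≤ a.toZdLanIdx.k → ∀ (y : Site θ.D) (i : Fin θ.D), φ n (y + ((Pf ν : ℤ) / (θ.L : ℤ) ^ n) • e i) = φ n y) →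
          qs (c (q (g (g (qs φ))))) = qs φ) ∧
        (∀ (f : Site θ.D → θ.𝔸), ∀ x ∈ a.toZdLanIdx.Ω 0, Δ f x = covLap a.toZdLanIdx.η a.toZdLanIdx.U₀ ((a.toZdLanIdx.Ω 0).indicator f) x) ∧
        (∀ (μ : ℕ → Site θ.D → θ.𝔸), ∀ x ∈ a.toZdLanIdx.Ω 0, qs μ x = QT θ.L a.toZdLanIdx.k a.toZdLanIdx.Λ a.toZdLanIdx.U₀ μ x) ∧
        (∀ (f : Site θ.D → θ.𝔸) (n : ℕ), n ≤ a.toZdLanIdx.k → ∀ y ∈ a.toZdLanIdx.Λ n, q f n y = QprimeIter (zdBlocking θ.D θ.L) (bgT θ.L a.toZdLanIdx.U₀) n f y) ∧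
        (∀ (f : Site θ.D → θ.𝔸) (n : ℕ) (y : Site θ.D), ¬ (n ≤ a.toZdLanIdx.k ∧ y ∈ a.toZdLanIdx.Λ n) → q f n y = 0) ∧
        (∀ (f : Site θ.D → θ.𝔸) (z : Site θ.D) (i : Fin θ.D), g f (z + (Pf ν : ℤ) • e i) = g f z) ∧
        (∀ μ : ℕ → Site θ.D → θ.𝔸, ∀ n, n ≤ a.toZdLanIdx.k → ∀ (y : Site θ.D) (i : Fin θ.D), Aw μ n (y + ((Pf ν : ℤ) / (θ.L : ℤ) ^ n) • e i) = Aw μ n y) ∧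
        (∀ (X : XSpace θ.D a.toZdLanIdx.k θ.𝔸) (x : Site θ.D), ‖H' X x‖ ≤ B₀'H * ‖X‖) ∧
        (∀ n, n ≤ a.toZdLanIdx.k → ∀ (X : XSpace θ.D a.toZdLanIdx.k θ.𝔸), ∀ b ∈ {b : Site θ.D × Fin θ.D | SideTouches (a.toZdLanIdx.Ω n) b.1 b.2},
          wt θ.L a.toZdLanIdx.η n * ‖covDerivFwd a.toZdLanIdx.η a.toZdLanIdx.U₀ b.2 (H' X) b.1‖ ≤ B₀'H * ‖X‖) ∧
        (∀ X : XSpace θ.D a.toZdLanIdx.k θ.𝔸, Bd2 θ.L a.toZdLanIdx.η a.toZdLanIdx.k a.toZdLanIdx.Ω (covLap a.toZdLanIdx.η a.toZdLanIdx.U₀ (H' X)) (B₂' * ‖X‖)) ∧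
        (∀ X : XSpace θ.D a.toZdLanIdx.k θ.𝔸, (∀ (q : Fin (a.toZdLanIdx.k + 1) × Site θ.D) (i : Fin θ.D), X (q.1, q.2 + ((Pf ν : ℤ) / (θ.L : ℤ) ^ (q.1 : ℕ)) • e i) = X q) →
          ∀ (z : Site θ.D) (i : Fin θ.D), H' X (z + (Pf ν : ℤ) • e i) = H' X z) ∧
        (∀ (Y : XSpace θ.D a.toZdLanIdx.k θ.𝔸), (∀ (q : Fin (a.toZdLanIdx.k + 1) × Site θ.D) (i : Fin θ.D), Y (q.1, q.2 + ((Pf ν : ℤ) / (θ.L : ℤ) ^ (q.1 : ℕ)) • e i) = Y q) →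
          ∀ (n : ℕ) (hn : n ≤ a.toZdLanIdx.k) (y : Site θ.D), y ∈ a.toZdLanIdx.Λ n →
          QprimeIter (zdBlocking θ.D θ.L) (bgT θ.L a.toZdLanIdx.U₀) n (H' Y) y = Y (⟨n, Nat.lt_succ_of_le hn⟩, y)) ∧
        (∀ (f : Site θ.D → θ.𝔸) (r : ℝ), 0 ≤ r → Bd2 θ.L a.toZdLanIdx.η a.toZdLanIdx.k a.toZdLanIdx.Ω f r →
          (∀ x, ‖g f x‖ ≤ BG * r) ∧ ∀ n, n ≤ a.toZdLanIdx.k → ∀ b ∈ {b : Site θ.D × Fin θ.D | SideTouches (a.toZdLanIdx.Ω n) b.1 b.2},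
            wt θ.L a.toZdLanIdx.η n * ‖covDerivFwd a.toZdLanIdx.η a.toZdLanIdx.U₀ b.2 (g f) b.1‖ ≤ BG * r) ∧
        (∀ (f : Site θ.D → θ.𝔸) (r : ℝ), 0 ≤ r → Bd2 θ.L a.toZdLanIdx.η a.toZdLanIdx.k a.toZdLanIdx.Ω f r →
          Bd2 θ.L a.toZdLanIdx.η a.toZdLanIdx.k a.toZdLanIdx.Ω (f - g (qs (c (q (g f))))) (BR * r))) :
    ∃ (inp : B8.B9Inputs) (B₀β B₈ c₄ c₃ : ℝ),
      inp.B₀ = max 1 (2 * B₀N * max 1 (qQ θ.D θ.L Cτ (betaTau τ) 1)) ∧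
      inp.B₀' = 6 * (2 * (θ.D : ℝ) * (θ.L : ℝ) ^ 2) * BG * BR + 1 ∧
      B₀β = 2 * max 0 Cβ * max 1 (qQ θ.D θ.L Cτ (betaTau τ) 1) ∧
      inp.B₀ ≤ B₈ ∧ 0 < c₄ ∧ 0 < c₃ ∧
      ∀ (ν : ι) (a : IdxB8SubDPerκ θ (Pf ν) Mκ Rκ),
        B8.Thm4Body c₄ (5 * (θ.D : ℝ) * θ.L * B₈) (fun _ : Unit => (zdGF3HP₂Per θ.𝔸 θ.L β len a.toZdIdx (Pf ν)).toGFData) ∧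
        B8.Prop3Body c₃ θ.D (θ.L : ℝ) (2097152 * ((θ.D : ℝ) + 1) ^ 2 * (θ.L : ℝ) ^ 2) inp B₀β
          (fun _ : Unit => (zdGF3HP₂Per θ.𝔸 θ.L β len a.toZdIdx (Pf ν)).toGFData2) := by
  have hd1 : 1 ≤ θ.D := le_trans one_le_two hD
  have hL1 : 1 ≤ θ.L := le_trans one_le_two θ.two_le_L
  -- THE RECIPE (ζ-L's): N06's pinned `B₀, B₀β, γ′, γβ` at `γ₈ := 1` (kept LITERAL — N06's servers print them), the free scalars `B₈, B₈β, B₀′` (named), `door_arith`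
  have hB₀1 : (1 : ℝ) ≤ max 1 (2 * B₀N * max 1 (qQ θ.D θ.L Cτ (betaTau τ) 1)) := le_max_left _ _
  have hB₀ : 0 < max 1 (2 * B₀N * max 1 (qQ θ.D θ.L Cτ (betaTau τ) 1)) := lt_of_lt_of_le one_pos hB₀1
  have hγ'0 : 0 ≤ 2 * cS * (1 : ℝ) / max 1 (2 * B₀N * max 1 (qQ θ.D θ.L Cτ (betaTau τ) 1)) :=
    div_nonneg (by positivity) hB₀.le
  have hB₀β : 0 < 2 * max 0 Cβ * max 1 (qQ θ.D θ.L Cτ (betaTau τ) 1) :=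
    mul_pos (mul_pos two_pos (lt_of_lt_of_le hCβ (le_max_right _ _))) (lt_of_lt_of_le one_pos (le_max_left _ _))
  have hγβ0 : 0 ≤ (max 0 Cβ * cS / B₀N + cSβ) * (1 : ℝ) := by positivity
  obtain ⟨B₈, hB₈eq⟩ : ∃ B₈ : ℝ, B₈ = max 1 (2 * B₀N * max 1 (qQ θ.D θ.L Cτ (betaTau τ) 1)) +
      2 * cS * (1 : ℝ) / max 1 (2 * B₀N * max 1 (qQ θ.D θ.L Cτ (betaTau τ) 1)) * max 1 (2 * B₀N * max 1 (qQ θ.D θ.L Cτ (betaTau τ) 1)) + 1 := ⟨_, rfl⟩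
  obtain ⟨B₈β, hB₈βeq⟩ : ∃ B₈β : ℝ, B₈β = 2 * max 0 Cβ * max 1 (qQ θ.D θ.L Cτ (betaTau τ) 1) +
      2 * (2 * max 0 Cβ * max 1 (qQ θ.D θ.L Cτ (betaTau τ) 1)) *
        (2 * cS * (1 : ℝ) / max 1 (2 * B₀N * max 1 (qQ θ.D θ.L Cτ (betaTau τ) 1)) * max 1 (2 * B₀N * max 1 (qQ θ.D θ.L Cτ (betaTau τ) 1))) +
      (max 0 Cβ * cS / B₀N + cSβ) * (1 : ℝ) := ⟨_, rfl⟩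
  obtain ⟨B₀', hB₀'eq⟩ : ∃ B₀' : ℝ, B₀' = 6 * (2 * (θ.D : ℝ) * (θ.L : ℝ) ^ 2) * BG * BR + 1 := ⟨_, rfl⟩
  obtain ⟨hB₀', hB, hB₀8, hγB, -, -, -, hfreeS⟩ :=
    door_arith θ.D θ.L hD θ.two_le_L hB₀1 hγ'0 hB₀β.le hγβ0 one_pos hBG hBR hB₈eq hB₈βeq hB₀'eq
  have h5 : 0 ≤ 5 * (θ.D : ℝ) * θ.L := by positivity
  have hB8 : 2 ≤ 5 * (θ.D : ℝ) * θ.L * B₈ := hB.trans (mul_le_mul_of_nonneg_left hB₀8 h5)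
  have hB₈ : 0 < B₈ := lt_of_lt_of_le hB₀ hB₀8
  have hγB2 : 2 * (2 * cS * (1 : ℝ) / max 1 (2 * B₀N * max 1 (qQ θ.D θ.L Cτ (betaTau τ) 1)) * max 1 (2 * B₀N * max 1 (qQ θ.D θ.L Cτ (betaTau τ) 1))) ≤
      5 * (θ.D : ℝ) * θ.L * B₈ := by
    have h0 : 0 ≤ 5 * (θ.D : ℝ) * θ.L * max 1 (2 * B₀N * max 1 (qQ θ.D θ.L Cτ (betaTau τ) 1)) := mul_nonneg h5 hB₀.le
    linarith
  -- THE SOCKET THRESHOLDS OF (13)′α…ε-L, all chosen before the period: `c_P₃′`, `c_P₃`, `c_P₇`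
  have hden : 0 < 2 * B₀N * (14 * ((θ.D - 1 : ℕ) : ℝ)) * M + 1 := by positivity
  have hcP3' : 0 < min (1 / 16) (min aI (min aT (1 / (2 * B₀N * (14 * ((θ.D - 1 : ℕ) : ℝ)) * M + 1)))) :=
    lt_min (by norm_num) (lt_min haI (lt_min haT (one_div_pos.2 hden)))
  have hcP3 : 0 < min (1 / 16) (min aI (min aT (min aS (1 / (2 * B₀N * (14 * ((θ.D - 1 : ℕ) : ℝ)) * M + 1))))) :=
    lt_min (by norm_num) (lt_min haI (lt_min haT (lt_min haS (one_div_pos.2 hden))))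
  have hK₀ : 0 < 2 * (θ.L * (5 * (θ.D : ℝ) * θ.L * B₈)) + 8 * (8 * B₀' * (5 * (θ.D : ℝ) * θ.L * B₈)) := by
    have h1 : 0 < 5 * (θ.D : ℝ) * θ.L * B₈ := lt_of_lt_of_le two_pos hB8
    positivity
  have hcP₇ : 0 < min (min (1 / 16) (min aI (min aT (min aS (1 / (2 * B₀N * (14 * ((θ.D - 1 : ℕ) : ℝ)) * M + 1))))))
      ((min (1 / 16) (min aI (min aT (min aS (1 / (2 * B₀N * (14 * ((θ.D - 1 : ℕ) : ℝ)) * M + 1)))))) /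
        (2 * (θ.L * (5 * (θ.D : ℝ) * θ.L * B₈)) + 8 * (8 * B₀' * (5 * (θ.D : ℝ) * θ.L * B₈)))) := lt_min hcP3 (div_pos hcP3 hK₀)
  obtain ⟨c7, hc7eq⟩ : ∃ c : ℝ, c = min (min (1 / 16) (min aI (min aT (min aS (1 / (2 * B₀N * (14 * ((θ.D - 1 : ℕ) : ℝ)) * M + 1)))))) ((min (1 / 16) (min aI (min aT (min aS (1 / (2 * B₀N * (14 * ((θ.D - 1 : ℕ) : ℝ)) * M + 1)))))) / (2 * (θ.L * (5 * (θ.D : ℝ) * θ.L * B₈)) + 8 * (8 * B₀' * (5 * (θ.D : ℝ) * θ.L * B₈)))) := ⟨_, rfl⟩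
  have hc7 : 0 < c7 := by rw [hc7eq]; exact hcP₇
  -- THE ALL-PERIODS INDEX `J := Σ ν, IdxB8SubDPerκ θ (Pf ν) Mκ Rκ`, member map `q ↦ q.2.toZdIdx`, period map `q ↦ Pf q.1`; the towers' shift law in the letters' currency
  have hΛκ : ∀ q : (Σ ν : ι, IdxB8SubDPerκ θ (Pf ν) Mκ Rκ), ∀ j, j ≤ q.2.toZdIdx.k → ∀ (y : Site θ.D) (i : Fin θ.D),
      y + ((Pf q.1 : ℤ) / (θ.L : ℤ) ^ j) • e i ∈ q.2.toZdIdx.Λs q.2.toZdIdx.k j ↔ y ∈ q.2.toZdIdx.Λs q.2.toZdIdx.k j :=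
    fun q j hj y i => IdxB8SubDPer.Λs_add_div_smul_iff q.2.1 hj y i
  -- NODE N06's GUARDED SOURCED b9 SOCKET OF THEOREM 4's FRAME `SH59src` at every member of every period, every truncation (dag-n06-b FILE 7 §3, index-generic), threshold `c_P₇`
  have SH59src := sockH59srcPer_opsAllZdPer_towerBondsP θ.L τ hD θ.two_le_L hτp hτt hτs hCτ ops₀ hM1
    (fun q : (Σ ν : ι, IdxB8SubDPerκ θ (Pf ν) Mκ Rκ) => q.2.toZdIdx) (fun q => Pf q.1) (fun q => ⟨(q.2.pos).ne'⟩) (fun q => q.2.Ω_zero) (s := 1) (fun q => q.2.dvd)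
    (fun q m hm j hj κ => B8PeriodicMemberGeometry.IdxB8SubD.isPeriodic_towerBondsP_Λs q.2.1.1 (fun l _ => q.2.1.periodic l) hm hj (q.2.1.pow_mul_div (hj.trans hm)).symm κ)
    (fun q m hm => levelSepPP0_of_levelSepPP (IdxB8SubD.levelSepPP_towerBondsP q.2.1.1 m hm))
    (β := β) (len := len) (fun q => hinv q.1 q.2) (fun q => hglob q.1 q.2) (fun q => hhol q.1 q.2) (fun q => hsrc q.1 q.2) (fun q => hsrcH q.1 q.2)
    hB₀N hcS hcSβ 1 (B₈ := B₈) (B₀'' := B₀') hB₈ hB₀'.le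
  -- NODE N06's GUARDED BOTH-POINTS SOCKET OF PROPOSITION 3's FRAME at every member of every period, truncation `k` (dag-n06-b FILE 8 §3), threshold `c_P₃′`
  have SB9H2Per : ∀ q : (Σ ν : ι, IdxB8SubDPerκ θ (Pf ν) Mκ Rκ), SockB9P3H2Per (𝔸 := θ.𝔸) (Pf q.1) θ.L (max 1 (2 * B₀N * max 1 (qQ θ.D θ.L Cτ (betaTau τ) 1)))
      (2 * max 0 Cβ * max 1 (qQ θ.D θ.L Cτ (betaTau τ) 1)) (min (1 / 16) (min aI (min aT (1 / (2 * B₀N * (14 * ((θ.D - 1 : ℕ) : ℝ)) * M + 1))))) β len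
      q.2.toZdIdx.η q.2.toZdIdx.k q.2.toZdIdx.Ω q.2.toZdIdx.Λs (fun m l => towerBondsP θ.L q.2.toZdIdx.Ω (q.2.toZdIdx.Λs m) l) := fun q => by
    haveI : NeZero (Pf q.1) := ⟨(q.2.pos).ne'⟩
    exact sockB9P3H2Per_opsAllZdPer_towerBondsP θ.L τ (Pf q.1) hD θ.two_le_L hτp hτt hτs hCτ ops₀ hM1 q.2.toZdIdx q.2.Ω_zero q.2.dvd
      (fun j hj κ => B8PeriodicMemberGeometry.IdxB8SubD.isPeriodic_towerBondsP_Λs q.2.1.1 (fun l _ => q.2.1.periodic l) le_rfl hj (q.2.1.pow_mul_div hj).symm κ)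
      (levelSepPP0_of_levelSepPP (IdxB8SubD.levelSepPP_towerBondsP q.2.1.1 _ le_rfl)) (hinv q.1 q.2 _ le_rfl) (hglob q.1 q.2 _ le_rfl) (hhol q.1 q.2 _ le_rfl) hB₀N
  -- THE JOIN's SOURCED WINDOWS AND THE γ WINDOWS, once (dag-n05-w4 ∕ lit-balaban p21)
  obtain ⟨cW, hcW, hW⟩ := hfpWindows_of_guard_src (d := θ.D) hd1 hL1 hB₈ hB₀' hB8 hB₀'H hB₂' hBG hBR zero_le_one hfreeS
  obtain ⟨cγ, hcγ, hWγ⟩ := gammaWindows_of_guard (d := θ.D) hd1 hL1 hB₈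
  -- THE SOURCED BASE SOCKET `SP5base` SERVED at every member of every period (lit-balaban's index-generic nested server, EDITION «L»), threshold `min c_W c_L`
  have SP5base := sockP5baseSrcPerL_of_lettersAtPerNested (𝔸 := θ.𝔸) (γ := 1) hD θ.two_le_L hB₀' hB₈ hB₀'H hB₂' hBG hBR zero_le_one
    (fun q : (Σ ν : ι, IdxB8SubDPerκ θ (Pf ν) Mκ Rκ) => q.2.toZdIdx) (fun q => Pf q.1)
    (fun q => IdxB8SubB.tower_all q.2.1.1.1.1) (fun q j hj => by exact_mod_cast q.2.1.dvd_level hj)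
    (fun q m hm j hj y i => by
      have h := q.2.1.mem_Λs_add_smul_iff hm hj y (e i)
      simp only [Int.natCast_div, Nat.cast_pow] at h
      exact h)
    (fun q j _ => q.2.periodic j) hB8 (fun q => hLet q.1 q.2)
    (fun α₀ α₁ hα₀ hα₁ hs cs α₄ cB cDA hE hE₂ lE lE₂ e1 e2 e3 e4 e5 e6 e7 e8 => by
      obtain ⟨w1, w2, w3, w4, w5, w6, w7, w8, w9, w10, w11, w12, w13, w14, w15, w16, w17, w18, w19, w20, w21, w22, w23, w24, w25, -, -, -⟩ :=
        hW α₀ α₁ hα₀ hα₁ (hs.trans (min_le_left cW cL)) cs α₄ cB cDA hE hE₂ lE lE₂ e1 e2 e3 e4 e5 e6 e7 e8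
      exact ⟨w1, w2, w3, w4, w5, w6, w7, w8, w9, w10, w11, w12, w13, w14, w15, w16, w17, w18, w19, w20, w21, w22, w23, w24, w25⟩)
    (min_le_right cW cL)
  -- THE SOURCED STEP SOCKET `SP5` SERVED at every member of every period (index-generic nested server, EDITION «L»; b9 input := N06's `SH59src`), threshold `min c_W (min c_P₇ (min c_γ c_L))`
  have hm₁ : min cW (min c7 (min cγ cL)) ≤ cW := min_le_left _ _
  have hm₂ : min cW (min c7 (min cγ cL)) ≤ c7 := (min_le_right _ _).trans (min_le_left _ _)
  have hm₃ : min cW (min c7 (min cγ cL)) ≤ cγ := (min_le_right _ _).trans ((min_le_right _ _).trans (min_le_left _ _))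
  have hm₄ : min cW (min c7 (min cγ cL)) ≤ cL := (min_le_right _ _).trans ((min_le_right _ _).trans (min_le_right _ _))
  have SP5 := sockP5SrcPerL_of_lettersAtPerNested (𝔸 := θ.𝔸) (γ := 1) hD θ.two_le_L hB₀ hB₀' hB₈ hB₀'H hB₂' hBG hBR zero_le_one hγ'0 hB₀8 hγB2
    (fun q : (Σ ν : ι, IdxB8SubDPerκ θ (Pf ν) Mκ Rκ) => q.2.toZdIdx) (fun q => Pf q.1)
    (fun q => IdxB8SubB.tower_all q.2.1.1.1.1) (fun q => q.2.1.laws.trunc_lt) (fun q => q.2.1.laws.trunc_top)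
    (fun q j hj => by exact_mod_cast q.2.1.dvd_level hj)
    (fun q m hm j hj y i => by
      have h := q.2.1.mem_Λs_add_smul_iff hm hj y (e i)
      simp only [Int.natCast_div, Nat.cast_pow] at h
      exact h)
    (fun q j _ => q.2.periodic j)
    (fun q α₀ α₁ hα₀ hα₁ hs => SH59src q α₀ α₁ hα₀ hα₁ (hs.trans (hm₂.trans hc7eq.le))) (fun q => hLet q.1 q.2)
    (fun α₀ α₁ hα₀ hα₁ hs cs α₄ cB cDA hE hE₂ lE lE₂ e1 e2 e3 e4 e5 e6 e7 e8 => by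
      obtain ⟨w1, w2, w3, w4, w5, w6, w7, w8, w9, w10, w11, w12, w13, w14, w15, w16, w17, w18, w19, w20, w21, w22, w23, w24, w25, -, -, -⟩ :=
        hW α₀ α₁ hα₀ hα₁ (hs.trans hm₁) cs α₄ cB cDA hE hE₂ lE lE₂ e1 e2 e3 e4 e5 e6 e7 e8
      exact ⟨w1, w2, w3, w4, w5, w6, w7, w8, w9, w10, w11, w12, w13, w14, w15, w16, w17, w18, w19, w20, w21, w22, w23, w24, w25⟩)
    (fun α₀ α₁ hα₀ hα₁ hs => hWγ α₀ α₁ hα₀ hα₁ (hs.trans hm₃))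
    hm₄
  -- THE UNIQUENESS SOCKET `SP5u` (p21's instance-(ii) server): radius `c_u`, threshold `c_P⁵ᵘ` — from the constants; its b9 input := N06's `SH59src` at `c_P₇`
  obtain ⟨cu, cPu, hcu, hcPu, HSP5u⟩ := sockP5uSrcPer_of_lettersAtPerNested (𝔸 := θ.𝔸)
    (B₀ := max 1 (2 * B₀N * max 1 (qQ θ.D θ.L Cτ (betaTau τ) 1))) (B₀' := B₀') (B₈ := B₈) (γ := 1)
    (γ' := 2 * cS * (1 : ℝ) / max 1 (2 * B₀N * max 1 (qQ θ.D θ.L Cτ (betaTau τ) 1)))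
    (c59 := c7)
    hD θ.two_le_L hB8 hcL hB₀ hB₀' hB₀'H hB₂' hBG hBR zero_le_one hγ'0 hB₀8 hγB hc7
  -- ONE THRESHOLD `c_α` FOR THE FOUR SOCKETS OF THEOREM 4's FRAME
  obtain ⟨cα, hcα, hαb, hα5, hα7, hαu⟩ : ∃ c : ℝ, 0 < c ∧ c ≤ min cW cL ∧ c ≤ min cW (min c7 (min cγ cL)) ∧ c ≤ c7 ∧ c ≤ cPu :=
    ⟨min (min (min cW cL) (min cW (min c7 (min cγ cL)))) (min c7 cPu),
      lt_min (lt_min (lt_min hcW hcL) (lt_min hcW (lt_min hc7 (lt_min hcγ hcL)))) (lt_min hc7 hcPu),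
      (min_le_left _ _).trans (min_le_left _ _), (min_le_left _ _).trans (min_le_right _ _),
      (min_le_right _ _).trans (min_le_left _ _), (min_le_right _ _).trans (min_le_right _ _)⟩
  -- THE ZERO SOURCE is admitted at every member ∕ pair ∕ background ((10)′ A's `hAdm₀`, index `J`)
  have hAdm₀ : ∀ q : (Σ ν : ι, IdxB8SubDPerκ θ (Pf ν) Mκ Rκ), ∀ α₀ α₁ : ℝ, 0 < α₀ → 0 < α₁ → ∀ U₀ : Site θ.D → Fin θ.D → θ.𝔸ˣ, (∀ x κ, U₀ x κ ∈ unitaryUnits θ.𝔸) →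
      (((InR138 θ.L q.2.toZdIdx.k q.2.toZdIdx.η (q.2.toZdIdx.Ω 0) (q.2.toZdIdx.Λs q.2.toZdIdx.k) U₀ 0 ∧ (∀ x, IsSelfAdjoint ((0 : Site θ.D → θ.𝔸) x)) ∧
          (∀ x, x ∉ q.2.toZdIdx.Ω 0 → (0 : Site θ.D → θ.𝔸) x = 0) ∧
          Bdd θ.L q.2.toZdIdx.k q.2.toZdIdx.η (-(2 : ℝ)) (fun j (x : Site θ.D) => x ∈ q.2.toZdIdx.Ω j) 0) ∧ IsPeriodic (Pf q.1) (0 : Site θ.D → θ.𝔸)) ∧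
        msup θ.L q.2.toZdIdx.k q.2.toZdIdx.η (-(2 : ℝ)) (fun j (x : Site θ.D) => x ∈ q.2.toZdIdx.Ω j) 0 < 1 * (α₀ + α₁)) :=
    fun q α₀ α₁ hα₀ hα₁ U₀ _ => by
      have hBdd0 : Bdd θ.L q.2.toZdIdx.k q.2.toZdIdx.η (-(2 : ℝ)) (fun j (x : Site θ.D) => x ∈ q.2.toZdIdx.Ω j) (0 : Site θ.D → θ.𝔸) :=
        bdd_of_forall (c := 0) fun _ _ _ _ => by simp
      have hmsup0 : msup θ.L q.2.toZdIdx.k q.2.toZdIdx.η (-(2 : ℝ)) (fun j (x : Site θ.D) => x ∈ q.2.toZdIdx.Ω j) (0 : Site θ.D → θ.𝔸) ≤ 0 :=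
        msup_le le_rfl fun _ _ _ _ => by simp
      exact ⟨⟨⟨inR138_zero q.2.toZdIdx.η θ.L U₀ q.2.toZdIdx.k (q.2.toZdIdx.Ω 0) (q.2.toZdIdx.Λs q.2.toZdIdx.k), fun _ => IsSelfAdjoint.zero θ.𝔸, fun _ _ => rfl,
          hBdd0⟩, fun _ _ => rfl⟩, lt_of_le_of_lt hmsup0 (mul_pos one_pos (add_pos hα₀ hα₁))⟩
  -- THEOREM 4's BODY, ONE THRESHOLD BEFORE THE INDEX `J` (dag-n05-a's index-generic `thm4Body_zdGF3HP₂Per_mapJ_γ'`; sockets cut to `c_α`, antitone)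
  obtain ⟨c₄, hc₄, H4⟩ := thm4Body_zdGF3HP₂Per_mapJ_γ' (𝔸 := θ.𝔸) (β := β) (len := len) hD θ.two_le_L hB₀ hB₀' hcu hcα hγ'0 hB₈ hB₀8 hB8 hγB
    (fun q : (Σ ν : ι, IdxB8SubDPerκ θ (Pf ν) Mκ Rκ) => q.2.toZdIdx) (fun q => Pf q.1)
    (fun q f U₀ a0 b0 => ((InR138 θ.L q.2.toZdIdx.k q.2.toZdIdx.η (q.2.toZdIdx.Ω 0) (q.2.toZdIdx.Λs q.2.toZdIdx.k) U₀ f ∧ (∀ x, IsSelfAdjoint (f x)) ∧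
        (∀ x, x ∉ q.2.toZdIdx.Ω 0 → f x = 0) ∧ Bdd θ.L q.2.toZdIdx.k q.2.toZdIdx.η (-(2 : ℝ)) (fun j (x : Site θ.D) => x ∈ q.2.toZdIdx.Ω j) f) ∧ IsPeriodic (Pf q.1) f) ∧
      msup θ.L q.2.toZdIdx.k q.2.toZdIdx.η (-(2 : ℝ)) (fun j (x : Site θ.D) => x ∈ q.2.toZdIdx.Ω j) f < 1 * (a0 + b0))
    (fun q U₀ f m W => LanF146 θ.L q.2.toZdIdx.k q.2.toZdIdx.η (q.2.toZdIdx.Ω 0) q.2.toZdIdx.Λs U₀ f m W)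
    (fun q α₀ α₁ h₀ h₁ hs => SP5base q α₀ α₁ h₀ h₁ (hs.trans hαb))
    (fun q α₀ α₁ h₀ h₁ hs => SP5 q α₀ α₁ h₀ h₁ (hs.trans hα5))
    (fun q α₀ α₁ h₀ h₁ hs => SH59src q α₀ α₁ h₀ h₁ (hs.trans (hα7.trans hc7eq.le)))
    (fun q α₀ α₁ h₀ h₁ hs => HSP5u q.2.toZdIdx (Pf q.1)
      (fun φ U₀ a0 b0 => ((InR138 θ.L q.2.toZdIdx.k q.2.toZdIdx.η (q.2.toZdIdx.Ω 0) (q.2.toZdIdx.Λs q.2.toZdIdx.k) U₀ φ ∧ (∀ x, IsSelfAdjoint (φ x)) ∧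
          (∀ x, x ∉ q.2.toZdIdx.Ω 0 → φ x = 0) ∧ Bdd θ.L q.2.toZdIdx.k q.2.toZdIdx.η (-(2 : ℝ)) (fun j (x : Site θ.D) => x ∈ q.2.toZdIdx.Ω j) φ) ∧ IsPeriodic (Pf q.1) φ) ∧
        msup θ.L q.2.toZdIdx.k q.2.toZdIdx.η (-(2 : ℝ)) (fun j (x : Site θ.D) => x ∈ q.2.toZdIdx.Ω j) φ < 1 * (a0 + b0))
      (fun U₀ φ m W => LanF146 θ.L q.2.toZdIdx.k q.2.toZdIdx.η (q.2.toZdIdx.Ω 0) q.2.toZdIdx.Λs U₀ φ m W) (fun φ => φ)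
      (fun _ _ _ _ h => ⟨⟨h.1.1.2.2.2, h.2⟩, h.1.2⟩) (fun _ _ _ h => h.1) q.2.Ω_zero (by exact_mod_cast q.2.dvd) (hΛκ q)
      (fun α h0 hle U₀ hU₀ hper hIn => SLetUB q.1 ⟨q.2, U₀, hU₀, hper⟩ α h0 hle hIn)
      (fun α₀' α₁' h₀' h₁' hs' => SH59src q α₀' α₁' h₀' h₁' (hs'.trans hc7eq.le)) α₀ α₁ h₀ h₁ (hs.trans hαu))
    0 hAdm₀
    (fun q U₀ W => lanF146_zero_iff θ.L q.2.toZdIdx.k q.2.toZdIdx.η (q.2.toZdIdx.Ω 0) q.2.toZdIdx.Λs U₀ q.2.toZdIdx.k W)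
  -- PROPOSITION 3's BODY, ONE THRESHOLD BEFORE MEMBER AND PERIOD (dag-n05-a's `prop3Body_member_hp2per_γ_of_sockB9P3H2Per`), `inp := ⟨B₀, B₀′⟩`, `C₂ := 2097152(d+1)²L²`
  obtain ⟨c₃, hc₃, H3⟩ := prop3Body_member_hp2per_γ_of_sockB9P3H2Per (𝔸 := θ.𝔸) hD θ.two_le_L
    ⟨max 1 (2 * B₀N * max 1 (qQ θ.D θ.L Cτ (betaTau τ) 1)), B₀', hB₀, hB₀'⟩ hB₀β.le le_rfl hcP3' β len
  refine ⟨⟨max 1 (2 * B₀N * max 1 (qQ θ.D θ.L Cτ (betaTau τ) 1)), B₀', hB₀, hB₀'⟩, 2 * max 0 Cβ * max 1 (qQ θ.D θ.L Cτ (betaTau τ) 1), B₈, c₄, c₃,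
    rfl, hB₀'eq, rfl, hB₀8, hc₄, hc₃, fun ν a => ⟨?_, ?_⟩⟩
  · -- Theorem 4's body at the member `⟨ν, a⟩` of `J` (towers and domain periodicity from the index)
    exact H4 ⟨ν, a⟩ (IdxB8SubB.tower_all a.1.1.1.1) (fun j _ => a.periodic j)
  · -- Proposition 3's body at the member from N06's both-points socket
    exact H3 a.toZdIdx (Pf ν) (fun l _ => a.periodic l) (SB9H2Per ⟨ν, a⟩)

end UniformP

end Summit.QuantumFields.YangMills.BalabanUVNodes.N05SubBP2DK2PerKappaThm4Prop3BodiesUniformPOfBindersLettersPerDoorL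

end
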